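import Summits.Ventures.LatticeQCDFlow.Scaling.ExchangeSchemeCollector

/-!
HONEST FRAMING: exact (Metropolis-corrected) sampling algorithms for lattice gauge theory; figures
of merit are autocorrelation/cost numbers at stated couplings and volumes; no continuum-physics
claim.

# HubCollectorLaw — THE COUPON-COLLECTOR LAW OF THE HUB: FOR EVERY PROPOSAL LAW OVER THE HUB EDGES (ANY HUB LIST),
# EVERY UPDATE ALLOCATION `w`, EVERY FAMILY OF MAPS AND EVERY COLD KERNELS, FROM A CONFIGURATION THAT IS RARE AT THE
# COLD LEVELS (`Σ_{k≠0} μ_k(x_k) ≤ δ`): `t_mix(ε) ≥ (K/θ_Σ − 1)·log(K·η)` WITH `θ_Σ = t + (1−t)(1−w_0) ≤ 1` WHENEVER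
# `ε < 1 − η − δ`; IN PARTICULAR `t_mix(1/4) ≥ (K − 1)·log(K/4)`, AND `(K/t − 1)·log(K/4)` WITH HOT-ONLY UPDATES —
# ORDER `K·log K` AGAINST CHAPTER K's LINEAR FLOORS; SUCH STARTS EXIST AS SOON AS `|S| ≥ 4K` (lean-2 GEN-24, ours)

Venture-side (OURS).  Cell `lqcd-flow` (pub-lqcd), unit `pub-lqcd-lean-2-g24`, 2026-08-27.  Chapter L (the coupon-collector
law from a cold start), file 5.  The HUB LIST of `Scaling/FlowHubProposalLaw` (K4): `e_r = (0, κ_r + 1)` for an arbitrary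
`κ : Fin m → Fin K` (every rational proposal law over the hub edges; `c_k = #{r : κ_r = k}` the multiplicity of
`(0, k+1)`, `Σ_k c_k = m`), arbitrary maps `φ_r`, the weighted scheme `P = t·ptGraphSwap μ e φ + (1−t)·prodKernel w M`
with `μ_k`-reversible updates.  On a hub list the cold levels form a set no entry joins, the touch rate of level `k+1` is
`θ_{k+1} = t·c_k/m + (1−t)·w_{k+1}` (`Scaling/ExchangeSchemeCollector`), and their SUM is `θ_Σ = t + (1−t)(1−w_0) ≤ 1`
whatever `κ` and `w` — so by convexity the touch sum is at least `K·(1 − θ_Σ/K)ⁿ`: the freedom in the proposal law and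
in the allocation cannot raise the AVERAGE touch rate above `1/K`.

## What is proved

* §1 hub lists: `hubList_fst_ne_snd`, `hubList_cold_independent`, **`hubList_degree_succ`** (`deg(k+1) = c_k`),
  `hubList_sum_degree` (`Σ_k c_k = m`), **`hubList_touchRate_sum`** (`Σ_k θ_{k+1} = t + (1−t)(1−w_0)`).
* §2 **`sum_one_sub_pow_ge_jensen`** — `Σ_{k∈T}(1−θ_k)ⁿ ≥ |T|·(1 − (Σ_{k∈T}θ_k)/|T|)ⁿ` for `θ_k ≤ 1` (Jensen, `x ↦ xⁿ`
  convex on `[0,∞)`); **`hubList_touchSum_ge`** — `Σ_k (1−θ_{k+1})ⁿ ≥ K·(1 − θ_Σ/K)ⁿ`; `hubList_touchSum_ge_of_le_log`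
  — `n ≤ (K/θ_Σ − 1)·log(K·η) ⇒ Σ_k (1−θ_{k+1})ⁿ ≥ 1/η`.
* §3 **`hubList_mixingTime_ge` (THE COUPON-COLLECTOR LAW OF THE HUB)** — `K ≥ 1`, `0 < t`, a configuration `x` with
  `Σ_k μ_{k+1}(x_{k+1}) ≤ δ`, `0 < η`, `ε < 1 − η − δ`, the scheme `ε`-close to `π̃` at some time:
  **`t_mix(ε) ≥ (K/(t + (1−t)(1−w_0)) − 1)·log(K·η)`**; **`hubList_mixingTime_ge_quarter`** — `ε = η = δ = 1/4`:
  **`t_mix(1/4) ≥ (K/(t + (1−t)(1−w_0)) − 1)·log(K/4) ≥ (K − 1)·log(K/4)`** (`K ≥ 4`); **`hotOnlyHub_mixingTime_ge`** —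
  `w = 𝟙_{k=0}`: **`t_mix(1/4) ≥ (K/t − 1)·log(K/4)`**; `hotOnlyHub_swapBudget_ge` — **`t·t_mix(1/4) ≥ (K − t)·log(K/4)`**
  swap proposals, whatever the swap fraction.
* §4 **`exists_rare_coldStart`** — `4K ≤ |S|` ⇒ some configuration has `Σ_k μ_{k+1}(x_{k+1}) ≤ 1/4` (each law has an
  atom of mass `≤ 1/|S|`); `hubList_mixingTime_ge_of_card` — the quarter law with that start supplied.

Reading (no numerics implied): with one tunnelling replica feeding `K` cold ones through ANY schedule of hub swaps,
learned maps and update allocation, equilibrium in total variation from a generic atypical start needs order `K·log K`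
steps — `log K` above the relaxation-time floors of chapter K (`Scaling/ColdReplicaMixingFloor`: order `K`), because
every cold replica must be PROPOSED at least once and the last of `K` coupons takes `K·log K` draws; the swap fraction
`t` and the hot weight `w_0` enter only through `θ_Σ = t + (1−t)(1−w_0) ≤ 1`.  NOT CLAIMED: a matching `K·log K`
ceiling (the lazy ceilings of `Scaling/HubListCurrencies` are order `K·log(1/π̃_min)`); lists with cold–cold entries;
continuous spaces; anything measured.  Literature grade (cell rule): OWN COMPOSITION on KNOWN MECHANISM (coupon
collector, Levin–Peres–Wilmer §2.2 / Prop. 7.14); nothing cited as a fact; no new bib keys.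
-/

noncomputable section

open Finset Function
open Literature.Probability.MarkovChains

namespace Summit.Ventures.LatticeQCDFlow.Scaling

variable {S : Type*} [Fintype S] [DecidableEq S] {K m : ℕ} {μ : Fin (K + 1) → S → ℝ}
  {M : Fin (K + 1) → S → S → ℝ} {w : Fin (K + 1) → ℝ} {t : ℝ}

/-! ## §1 Hub lists: independence of the cold levels, degrees, the touch-rate sum -/

section HubList
variable (κ : Fin m → Fin K)

omit [Fintype S] [DecidableEq S] in
/-- A hub-list entry has distinct endpoints. [ours] -/
theorem hubList_fst_ne_snd : ∀ r : Fin m,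
    ((fun r : Fin m => (((0 : Fin (K + 1)), (κ r).succ) : Fin (K + 1) × Fin (K + 1))) r).1
      ≠ ((fun r : Fin m => (((0 : Fin (K + 1)), (κ r).succ) : Fin (K + 1) × Fin (K + 1))) r).2 :=
  fun r => (Fin.succ_ne_zero (κ r)).symm

omit [Fintype S] [DecidableEq S] in
/-- **No hub-list entry joins two cold levels:** the cold levels `univ.image Fin.succ` form a set no entry joins. [ours] -/
theorem hubList_cold_independent : ∀ r : Fin m,
    ¬(((fun r : Fin m => (((0 : Fin (K + 1)), (κ r).succ) : Fin (K + 1) × Fin (K + 1))) r).1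
          ∈ (univ : Finset (Fin K)).image Fin.succ ∧
      ((fun r : Fin m => (((0 : Fin (K + 1)), (κ r).succ) : Fin (K + 1) × Fin (K + 1))) r).2
          ∈ (univ : Finset (Fin K)).image Fin.succ) := by
  intro r ⟨h0, _⟩
  simp only [Finset.mem_image, Finset.mem_univ, true_and] at h0
  obtain ⟨j, hj⟩ := h0
  exact Fin.succ_ne_zero j hj

omit [Fintype S] [DecidableEq S] in
/-- **The list degree of the cold level `k+1` on a hub list is the multiplicity `c_k = #{r : κ_r = k}`.** [ours] -/
theorem hubList_degree_succ (k : Fin K) :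
    (univ.filter fun r : Fin m =>
        ((fun r : Fin m => (((0 : Fin (K + 1)), (κ r).succ) : Fin (K + 1) × Fin (K + 1))) r).1 = k.succ ∨
        ((fun r : Fin m => (((0 : Fin (K + 1)), (κ r).succ) : Fin (K + 1) × Fin (K + 1))) r).2 = k.succ)
      = univ.filter (fun r : Fin m => κ r = k) := by
  refine Finset.filter_congr fun r _ => ?_
  simp only [Fin.succ_inj]
  exact ⟨fun h => h.resolve_left (Fin.succ_ne_zero k).symm, fun h => Or.inr h⟩

omit [Fintype S] [DecidableEq S] in
/-- `Σ_k c_k = m`: every entry of a hub list has exactly one cold endpoint. [ours] -/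
theorem hubList_sum_degree : ∑ k : Fin K, ((univ.filter (fun r : Fin m => κ r = k)).card : ℝ) = m := by
  have h := Finset.card_eq_sum_card_fiberwise (f := κ) (s := (univ : Finset (Fin m))) (t := (univ : Finset (Fin K)))
    (fun r _ => mem_univ _)
  rw [card_univ, Fintype.card_fin] at h
  exact_mod_cast h.symm

omit [Fintype S] [DecidableEq S] in
/-- **THE TOUCH RATES OF THE COLD LEVELS SUM TO `θ_Σ = t + (1−t)(1−w_0)`** on every hub list, for every allocation
(`m ≥ 1`, `Σ w = 1`). [ours] -/
theorem hubList_touchRate_sum (hm : 1 ≤ m) (hw1 : ∑ k, w k = 1) :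
    ∑ k : Fin K, (t * ((univ.filter (fun r : Fin m => κ r = k)).card : ℝ) / m + (1 - t) * w k.succ)
      = t + (1 - t) * (1 - w 0) := by
  have hmpos : (0 : ℝ) < m := Nat.cast_pos.mpr (by omega)
  rw [sum_add_distrib]
  have h1 : ∑ k : Fin K, t * ((univ.filter (fun r : Fin m => κ r = k)).card : ℝ) / m = t := by
    have : ∑ k : Fin K, t * ((univ.filter (fun r : Fin m => κ r = k)).card : ℝ) / m
        = t / m * ∑ k : Fin K, ((univ.filter (fun r : Fin m => κ r = k)).card : ℝ) := by
      rw [mul_sum]; exact sum_congr rfl fun k _ => by ring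
    rw [this, hubList_sum_degree κ]; field_simp
  have h2 : ∑ k : Fin K, (1 - t) * w k.succ = (1 - t) * (1 - w 0) := by
    rw [← mul_sum]
    congr 1
    rw [Fin.sum_univ_succ] at hw1
    linarith
  rw [h1, h2]

end HubList

/-! ## §2 Jensen: the proposal law and the allocation cannot raise the average touch rate -/

omit [Fintype S] [DecidableEq S] in
/-- **Jensen for the touch sum:** `θ_k ≤ 1` on a non-empty `T` ⇒ `Σ_{k∈T}(1−θ_k)ⁿ ≥ |T|·(1 − (Σ_{k∈T}θ_k)/|T|)ⁿ`. [ours] -/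
theorem sum_one_sub_pow_ge_jensen {α : Type*} (T : Finset α) (hT : T.Nonempty) (θ : α → ℝ)
    (hθ1 : ∀ k ∈ T, θ k ≤ 1) (n : ℕ) :
    (T.card : ℝ) * (1 - (∑ k ∈ T, θ k) / T.card) ^ n ≤ ∑ k ∈ T, (1 - θ k) ^ n := by
  have hTpos : (0 : ℝ) < T.card := Nat.cast_pos.mpr hT.card_pos
  have hJ := (convexOn_pow n).map_sum_le (t := T) (w := fun _ => (1 : ℝ) / T.card) (p := fun k => 1 - θ k)
    (fun _ _ => by positivity) (by rw [sum_const, nsmul_eq_mul]; field_simp)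
    (fun k hk => Set.mem_Ici.mpr (by linarith [hθ1 k hk]))
  simp only [smul_eq_mul] at hJ
  have hL : ∑ k ∈ T, (1 : ℝ) / T.card * (1 - θ k) = 1 - (∑ k ∈ T, θ k) / T.card := by
    rw [← mul_sum, sum_sub_distrib, sum_const, nsmul_eq_mul, mul_one]; field_simp
  have hR : ∑ k ∈ T, (1 : ℝ) / T.card * (1 - θ k) ^ n = (1 / T.card) * ∑ k ∈ T, (1 - θ k) ^ n := by
    rw [mul_sum]
  rw [hL, hR] at hJ
  calc (T.card : ℝ) * (1 - (∑ k ∈ T, θ k) / T.card) ^ n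
      ≤ (T.card : ℝ) * ((1 / T.card) * ∑ k ∈ T, (1 - θ k) ^ n) := mul_le_mul_of_nonneg_left hJ hTpos.le
    _ = ∑ k ∈ T, (1 - θ k) ^ n := by field_simp

section Law
variable (κ : Fin m → Fin K) (φ : Fin m → Equiv.Perm S)

omit [Fintype S] [DecidableEq S] in
/-- **On a hub list the cold touch sum is at least `K·(1 − θ_Σ/K)ⁿ`, `θ_Σ = t + (1−t)(1−w_0)`**, for every `κ` and
every allocation (`K, m ≥ 1`, `0 ≤ t ≤ 1`, `w` a probability vector). [ours] -/
theorem hubList_touchSum_ge (hK : 1 ≤ K) (hm : 1 ≤ m) (hw0 : ∀ k, 0 ≤ w k) (hw1 : ∑ k, w k = 1) (ht0 : 0 ≤ t)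
    (ht1 : t ≤ 1) (n : ℕ) :
    (K : ℝ) * (1 - (t + (1 - t) * (1 - w 0)) / K) ^ n
      ≤ ∑ k : Fin K, (1 - (t * ((univ.filter (fun r : Fin m => κ r = k)).card : ℝ) / m + (1 - t) * w k.succ)) ^ n := by
  have hmpos : (0 : ℝ) < m := Nat.cast_pos.mpr (by omega)
  have hne : (univ : Finset (Fin K)).Nonempty := Finset.univ_nonempty_iff.mpr ⟨⟨0, by omega⟩⟩
  have hθ1 : ∀ k ∈ (univ : Finset (Fin K)),
      t * ((univ.filter (fun r : Fin m => κ r = k)).card : ℝ) / m + (1 - t) * w k.succ ≤ 1 := by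
    intro k _
    have hc : ((univ.filter (fun r : Fin m => κ r = k)).card : ℝ) ≤ m := by
      have := Finset.card_filter_le (univ : Finset (Fin m)) (fun r => κ r = k)
      rw [card_univ, Fintype.card_fin] at this; exact_mod_cast this
    have hwk : w k.succ ≤ 1 := by
      rw [← hw1]; exact Finset.single_le_sum (fun j _ => hw0 j) (mem_univ _)
    have h1 : t * ((univ.filter (fun r : Fin m => κ r = k)).card : ℝ) / m ≤ t := by
      rw [mul_div_assoc]; exact mul_le_of_le_one_right ht0 ((div_le_one hmpos).mpr hc)
    nlinarith [mul_le_mul_of_nonneg_left hwk (by linarith : (0 : ℝ) ≤ 1 - t)]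
  have hJ := sum_one_sub_pow_ge_jensen (univ : Finset (Fin K)) hne
    (fun k => t * ((univ.filter (fun r : Fin m => κ r = k)).card : ℝ) / m + (1 - t) * w k.succ) hθ1 n
  rw [card_univ, Fintype.card_fin, hubList_touchRate_sum κ hm hw1] at hJ
  exact hJ

omit [Fintype S] [DecidableEq S] in
/-- **Up to the hub's coupon-collector time the cold touch sum is large:** `K ≥ 2`, `0 < θ_Σ` (i.e. `t > 0` or
`w_0 < 1`), `0 < η`, `n ≤ (K/θ_Σ − 1)·log(K·η)` ⇒ `Σ_k (1−θ_{k+1})ⁿ ≥ 1/η`. [ours] -/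
theorem hubList_touchSum_ge_of_le_log (hK : 2 ≤ K) (hm : 1 ≤ m) (hw0 : ∀ k, 0 ≤ w k) (hw1 : ∑ k, w k = 1)
    (ht0 : 0 ≤ t) (ht1 : t ≤ 1) (hθpos : 0 < t + (1 - t) * (1 - w 0)) {η : ℝ} (hη : 0 < η) {n : ℕ}
    (hn : (n : ℝ) ≤ ((K : ℝ) / (t + (1 - t) * (1 - w 0)) - 1) * Real.log (K * η)) :
    1 / η ≤ ∑ k : Fin K, (1 - (t * ((univ.filter (fun r : Fin m => κ r = k)).card : ℝ) / m + (1 - t) * w k.succ)) ^ n := by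
  set θs := t + (1 - t) * (1 - w 0) with hθs_def
  have hKpos : (0 : ℝ) < K := Nat.cast_pos.mpr (by omega)
  have hK2 : (2 : ℝ) ≤ K := by exact_mod_cast hK
  have hKη : 0 < (K : ℝ) * η := mul_pos hKpos hη
  have hθsle1 : θs ≤ 1 := by rw [hθs_def]; nlinarith [hw0 0]
  have hlt : θs < K := by linarith
  have hθ0 : 0 < θs / K := div_pos hθpos hKpos
  have hθ1 : θs / K < 1 := (div_lt_one hKpos).mpr hlt
  have h1 : 0 < 1 - θs / K := by linarith
  have harg : (n : ℝ) * (θs / K) / (1 - θs / K) ≤ Real.log (K * η) := by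
    have e : (K : ℝ) / θs - 1 = (1 - θs / K) / (θs / K) := by field_simp
    rw [e] at hn
    have h := mul_le_mul_of_nonneg_left hn (div_pos hθ0 h1).le
    have e1 : θs / K / (1 - θs / K) * ((1 - θs / K) / (θs / K) * Real.log (K * η)) = Real.log (K * η) := by
      rw [← mul_assoc, div_mul_div_comm, mul_comm (θs / K) (1 - θs / K), div_self (mul_pos h1 hθ0).ne', one_mul]
    have e2 : θs / K / (1 - θs / K) * (n : ℝ) = n * (θs / K) / (1 - θs / K) := by ring
    rw [e1, e2] at h
    exact h
  calc 1 / η = (K : ℝ) * Real.exp (-Real.log (K * η)) := by rw [Real.exp_neg, Real.exp_log hKη]; field_simp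
    _ ≤ (K : ℝ) * Real.exp (-(n * (θs / K) / (1 - θs / K))) :=
        mul_le_mul_of_nonneg_left (Real.exp_le_exp.mpr (neg_le_neg harg)) hKpos.le
    _ ≤ (K : ℝ) * (1 - θs / K) ^ n := mul_le_mul_of_nonneg_left (one_sub_pow_ge_exp hθ1 n) hKpos.le
    _ ≤ _ := hubList_touchSum_ge κ (by omega) hm hw0 hw1 ht0 ht1 n

/-! ## §3 The coupon-collector law of the hub -/

/-- **THE COUPON-COLLECTOR LAW OF THE HUB:** on ANY hub list `e_r = (0, κ_r+1)` with ANY maps `φ_r`, ANY allocation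
`w` and `μ_k`-reversible updates (`K ≥ 2`, `m ≥ 1`, `0 ≤ t ≤ 1`, `θ_Σ = t + (1−t)(1−w_0) > 0`), from a configuration `x`
with `Σ_k μ_{k+1}(x_{k+1}) ≤ δ`, for `0 < η` and `ε < 1 − η − δ`, if the scheme is `ε`-close to `π̃` at some time:
**`t_mix(ε) ≥ (K/θ_Σ − 1)·log(K·η)`**. [ours] -/
theorem hubList_mixingTime_ge (hK : 2 ≤ K) (hm : 1 ≤ m) (hμ : ∀ k x, 0 < μ k x) (hμ1 : ∀ k, ∑ u, μ k u = 1)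
    (hM : ∀ k, IsRowStochastic (M k)) (hMrev : ∀ k, DetailedBalance (μ k) (M k)) (hw0 : ∀ k, 0 ≤ w k)
    (hw1 : ∑ k, w k = 1) (ht0 : 0 ≤ t) (ht1 : t ≤ 1) (hθpos : 0 < t + (1 - t) * (1 - w 0))
    (x : Fin (K + 1) → S) {η δ ε : ℝ} (hη : 0 < η) (hδ : ∑ k : Fin K, μ k.succ (x k.succ) ≤ δ)
    (hgap : ε < 1 - η - δ)
    (hmix : ∃ t₀, worstTvDist (fun y z : Fin (K + 1) → S =>
      t * ptGraphSwap μ (fun r : Fin m => (((0 : Fin (K + 1)), (κ r).succ) : Fin (K + 1) × Fin (K + 1))) φ y z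
        + (1 - t) * prodKernel w M y z) (tensorFun μ) t₀ ≤ ε) :
    ((K : ℝ) / (t + (1 - t) * (1 - w 0)) - 1) * Real.log (K * η)
      ≤ (mixingTime (fun y z : Fin (K + 1) → S =>
          t * ptGraphSwap μ (fun r : Fin m => (((0 : Fin (K + 1)), (κ r).succ) : Fin (K + 1) × Fin (K + 1))) φ y z
            + (1 - t) * prodKernel w M y z) (tensorFun μ) ε : ℝ) := by
  set n := mixingTime (fun y z : Fin (K + 1) → S =>
      t * ptGraphSwap μ (fun r : Fin m => (((0 : Fin (K + 1)), (κ r).succ) : Fin (K + 1) × Fin (K + 1))) φ y z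
        + (1 - t) * prodKernel w M y z) (tensorFun μ) ε with hn_def
  by_contra h
  push Not at h
  -- the touch sum over the cold levels, as a sum over `Fin K`
  set T : Finset (Fin (K + 1)) := (univ : Finset (Fin K)).image Fin.succ with hT_def
  have hinj : Set.InjOn (Fin.succ : Fin K → Fin (K + 1)) ((univ : Finset (Fin K)) : Set (Fin K)) :=
    fun a _ b _ hab => Fin.succ_inj.mp hab
  have hsumT : ∑ k ∈ T, (1 - (t * ((univ.filter fun r : Fin m =>
        ((fun r : Fin m => (((0 : Fin (K + 1)), (κ r).succ) : Fin (K + 1) × Fin (K + 1))) r).1 = k ∨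
        ((fun r : Fin m => (((0 : Fin (K + 1)), (κ r).succ) : Fin (K + 1) × Fin (K + 1))) r).2 = k).card : ℝ) / m
          + (1 - t) * w k)) ^ n
      = ∑ k : Fin K, (1 - (t * ((univ.filter (fun r : Fin m => κ r = k)).card : ℝ) / m + (1 - t) * w k.succ)) ^ n := by
    rw [hT_def, Finset.sum_image hinj]
    exact sum_congr rfl fun k _ => by rw [hubList_degree_succ κ k]
  have hmassT : ∑ k ∈ T, μ k (x k) = ∑ k : Fin K, μ k.succ (x k.succ) := by rw [hT_def, Finset.sum_image hinj]
  have hsge := hubList_touchSum_ge_of_le_log κ hK hm hw0 hw1 ht0 ht1 hθpos hη h.le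
  have hspos : 0 < ∑ k : Fin K,
      (1 - (t * ((univ.filter (fun r : Fin m => κ r = k)).card : ℝ) / m + (1 - t) * w k.succ)) ^ n :=
    lt_of_lt_of_le (by positivity) hsge
  have h1s : 1 / (∑ k : Fin K,
      (1 - (t * ((univ.filter (fun r : Fin m => κ r = k)).card : ℝ) / m + (1 - t) * w k.succ)) ^ n) ≤ η := by
    rw [one_div_le hspos hη]; exact hsge
  have hs' : 0 < ∑ k ∈ T, (1 - (t * ((univ.filter fun r : Fin m =>
        ((fun r : Fin m => (((0 : Fin (K + 1)), (κ r).succ) : Fin (K + 1) × Fin (K + 1))) r).1 = k ∨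
        ((fun r : Fin m => (((0 : Fin (K + 1)), (κ r).succ) : Fin (K + 1) × Fin (K + 1))) r).2 = k).card : ℝ) / m
          + (1 - t) * w k)) ^ n := by rw [hsumT]; exact hspos
  have hε' : ε < 1 - 1 / (∑ k ∈ T, (1 - (t * ((univ.filter fun r : Fin m =>
        ((fun r : Fin m => (((0 : Fin (K + 1)), (κ r).succ) : Fin (K + 1) × Fin (K + 1))) r).1 = k ∨
        ((fun r : Fin m => (((0 : Fin (K + 1)), (κ r).succ) : Fin (K + 1) × Fin (K + 1))) r).2 = k).card : ℝ) / m
          + (1 - t) * w k)) ^ n) - ∑ k ∈ T, μ k (x k) := by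
    rw [hsumT, hmassT]; linarith
  have key := exchangeScheme_lt_mixingTime (φ := φ) hm (hubList_fst_ne_snd κ) hμ hμ1 hM hMrev hw0 hw1 ht0 ht1 x T
    (hubList_cold_independent κ) n hs' hε' hmix
  exact lt_irrefl _ key

/-- **THE QUARTER LAW: `t_mix(1/4) ≥ (K/θ_Σ − 1)·log(K/4)`** (`ε = η = δ = 1/4`). [ours] -/
theorem hubList_mixingTime_ge_quarter (hK : 2 ≤ K) (hm : 1 ≤ m) (hμ : ∀ k x, 0 < μ k x) (hμ1 : ∀ k, ∑ u, μ k u = 1)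
    (hM : ∀ k, IsRowStochastic (M k)) (hMrev : ∀ k, DetailedBalance (μ k) (M k)) (hw0 : ∀ k, 0 ≤ w k)
    (hw1 : ∑ k, w k = 1) (ht0 : 0 ≤ t) (ht1 : t ≤ 1) (hθpos : 0 < t + (1 - t) * (1 - w 0))
    (x : Fin (K + 1) → S) (hx : ∑ k : Fin K, μ k.succ (x k.succ) ≤ 1 / 4)
    (hmix : ∃ t₀, worstTvDist (fun y z : Fin (K + 1) → S =>
      t * ptGraphSwap μ (fun r : Fin m => (((0 : Fin (K + 1)), (κ r).succ) : Fin (K + 1) × Fin (K + 1))) φ y z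
        + (1 - t) * prodKernel w M y z) (tensorFun μ) t₀ ≤ 1 / 4) :
    ((K : ℝ) / (t + (1 - t) * (1 - w 0)) - 1) * Real.log (K / 4)
      ≤ (mixingTime (fun y z : Fin (K + 1) → S =>
          t * ptGraphSwap μ (fun r : Fin m => (((0 : Fin (K + 1)), (κ r).succ) : Fin (K + 1) × Fin (K + 1))) φ y z
            + (1 - t) * prodKernel w M y z) (tensorFun μ) (1 / 4) : ℝ) := by
  have h := hubList_mixingTime_ge κ φ hK hm hμ hμ1 hM hMrev hw0 hw1 ht0 ht1 hθpos x (η := 1 / 4) (by norm_num) hx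
    (by norm_num : (1 : ℝ) / 4 < 1 - 1 / 4 - 1 / 4) hmix
  rwa [mul_one_div] at h

/-- **`t_mix(1/4) ≥ (K − 1)·log(K/4)` FOR EVERY PROPOSAL LAW OVER THE HUB EDGES, EVERY ALLOCATION, EVERY MAPS**
(`K ≥ 4`; since `θ_Σ ≤ 1`). [ours] -/
theorem hubList_mixingTime_ge_linearLog (hK : 4 ≤ K) (hm : 1 ≤ m) (hμ : ∀ k x, 0 < μ k x) (hμ1 : ∀ k, ∑ u, μ k u = 1)
    (hM : ∀ k, IsRowStochastic (M k)) (hMrev : ∀ k, DetailedBalance (μ k) (M k)) (hw0 : ∀ k, 0 ≤ w k)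
    (hw1 : ∑ k, w k = 1) (ht0 : 0 ≤ t) (ht1 : t ≤ 1) (hθpos : 0 < t + (1 - t) * (1 - w 0))
    (x : Fin (K + 1) → S) (hx : ∑ k : Fin K, μ k.succ (x k.succ) ≤ 1 / 4)
    (hmix : ∃ t₀, worstTvDist (fun y z : Fin (K + 1) → S =>
      t * ptGraphSwap μ (fun r : Fin m => (((0 : Fin (K + 1)), (κ r).succ) : Fin (K + 1) × Fin (K + 1))) φ y z
        + (1 - t) * prodKernel w M y z) (tensorFun μ) t₀ ≤ 1 / 4) :
    ((K : ℝ) - 1) * Real.log (K / 4)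
      ≤ (mixingTime (fun y z : Fin (K + 1) → S =>
          t * ptGraphSwap μ (fun r : Fin m => (((0 : Fin (K + 1)), (κ r).succ) : Fin (K + 1) × Fin (K + 1))) φ y z
            + (1 - t) * prodKernel w M y z) (tensorFun μ) (1 / 4) : ℝ) := by
  have h := hubList_mixingTime_ge_quarter κ φ (by omega) hm hμ hμ1 hM hMrev hw0 hw1 ht0 ht1 hθpos x hx hmix
  have hK4 : (4 : ℝ) ≤ K := by exact_mod_cast hK
  have hlog : 0 ≤ Real.log (K / 4) := Real.log_nonneg (by rw [le_div_iff₀ (by norm_num : (0:ℝ) < 4)]; linarith)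
  have hθle1 : t + (1 - t) * (1 - w 0) ≤ 1 := by nlinarith [hw0 0]
  have hfac : (K : ℝ) - 1 ≤ (K : ℝ) / (t + (1 - t) * (1 - w 0)) - 1 := by
    have : (K : ℝ) ≤ (K : ℝ) / (t + (1 - t) * (1 - w 0)) := by
      rw [le_div_iff₀ hθpos]; nlinarith
    linarith
  exact (mul_le_mul_of_nonneg_right hfac hlog).trans h

/-- **HOT-ONLY UPDATES: `t_mix(1/4) ≥ (K/t − 1)·log(K/4)`** — the star's `K·log K` law in the swap fraction (`K ≥ 2`,
`0 < t ≤ 1`, any hub list, any maps). [ours] -/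
theorem hotOnlyHub_mixingTime_ge (hK : 2 ≤ K) (hm : 1 ≤ m) (hμ : ∀ k x, 0 < μ k x) (hμ1 : ∀ k, ∑ u, μ k u = 1)
    (hM : ∀ k, IsRowStochastic (M k)) (hMrev : ∀ k, DetailedBalance (μ k) (M k)) (ht0 : 0 < t) (ht1 : t ≤ 1)
    (x : Fin (K + 1) → S) (hx : ∑ k : Fin K, μ k.succ (x k.succ) ≤ 1 / 4)
    (hmix : ∃ t₀, worstTvDist (fun y z : Fin (K + 1) → S =>
      t * ptGraphSwap μ (fun r : Fin m => (((0 : Fin (K + 1)), (κ r).succ) : Fin (K + 1) × Fin (K + 1))) φ y z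
        + (1 - t) * prodKernel (fun k : Fin (K + 1) => if k = 0 then (1 : ℝ) else 0) M y z) (tensorFun μ) t₀ ≤ 1 / 4) :
    ((K : ℝ) / t - 1) * Real.log (K / 4)
      ≤ (mixingTime (fun y z : Fin (K + 1) → S =>
          t * ptGraphSwap μ (fun r : Fin m => (((0 : Fin (K + 1)), (κ r).succ) : Fin (K + 1) × Fin (K + 1))) φ y z
            + (1 - t) * prodKernel (fun k : Fin (K + 1) => if k = 0 then (1 : ℝ) else 0) M y z) (tensorFun μ)
          (1 / 4) : ℝ) := by
  have hw0 : ∀ k : Fin (K + 1), 0 ≤ (if k = 0 then (1 : ℝ) else 0) := fun k => by split_ifs <;> norm_num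
  have hw1 : ∑ k : Fin (K + 1), (if k = 0 then (1 : ℝ) else 0) = 1 := by
    rw [Finset.sum_ite_eq' univ (0 : Fin (K + 1)), if_pos (mem_univ _)]
  have hθ : t + (1 - t) * (1 - (if (0 : Fin (K + 1)) = 0 then (1 : ℝ) else 0)) = t := by rw [if_pos rfl]; ring
  have h := hubList_mixingTime_ge_quarter κ φ hK hm hμ hμ1 hM hMrev hw0 hw1 ht0.le ht1 (by rw [hθ]; exact ht0) x hx hmix
  rwa [hθ] at h

/-- **THE SWAP BUDGET: `t·t_mix(1/4) ≥ (K − t)·log(K/4)`** — the expected number of swap PROPOSALS issued before the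
hot-only hub is `1/4`-mixed is at least `(K − t)·log(K/4) ≥ (K − 1)·log(K/4)`, whatever the swap fraction. [ours] -/
theorem hotOnlyHub_swapBudget_ge (hK : 2 ≤ K) (hm : 1 ≤ m) (hμ : ∀ k x, 0 < μ k x) (hμ1 : ∀ k, ∑ u, μ k u = 1)
    (hM : ∀ k, IsRowStochastic (M k)) (hMrev : ∀ k, DetailedBalance (μ k) (M k)) (ht0 : 0 < t) (ht1 : t ≤ 1)
    (x : Fin (K + 1) → S) (hx : ∑ k : Fin K, μ k.succ (x k.succ) ≤ 1 / 4)
    (hmix : ∃ t₀, worstTvDist (fun y z : Fin (K + 1) → S =>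
      t * ptGraphSwap μ (fun r : Fin m => (((0 : Fin (K + 1)), (κ r).succ) : Fin (K + 1) × Fin (K + 1))) φ y z
        + (1 - t) * prodKernel (fun k : Fin (K + 1) => if k = 0 then (1 : ℝ) else 0) M y z) (tensorFun μ) t₀ ≤ 1 / 4) :
    ((K : ℝ) - t) * Real.log (K / 4)
      ≤ t * (mixingTime (fun y z : Fin (K + 1) → S =>
          t * ptGraphSwap μ (fun r : Fin m => (((0 : Fin (K + 1)), (κ r).succ) : Fin (K + 1) × Fin (K + 1))) φ y z
            + (1 - t) * prodKernel (fun k : Fin (K + 1) => if k = 0 then (1 : ℝ) else 0) M y z) (tensorFun μ)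
          (1 / 4) : ℝ) := by
  have h := mul_le_mul_of_nonneg_left (hotOnlyHub_mixingTime_ge κ φ hK hm hμ hμ1 hM hMrev ht0 ht1 x hx hmix) ht0.le
  have e : t * (((K : ℝ) / t - 1) * Real.log (K / 4)) = ((K : ℝ) - t) * Real.log (K / 4) := by
    field_simp
  linarith [e]

/-! ## §4 Rare cold starts exist -/

omit [DecidableEq S] in
/-- Every probability vector on `S` has an atom of mass `≤ 1/|S|`. [ours] -/
theorem exists_apply_le_inv_card {ν : S → ℝ} (hν1 : ∑ u, ν u = 1) : ∃ u, ν u ≤ 1 / Fintype.card S := by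
  have hne : (univ : Finset S).Nonempty := by
    rcases (univ : Finset S).eq_empty_or_nonempty with h | h
    · exfalso; rw [h, Finset.sum_empty] at hν1; exact zero_ne_one hν1
    · exact h
  have : Nonempty S := Finset.univ_nonempty_iff.mp hne
  have hcard : (0 : ℝ) < Fintype.card S := Nat.cast_pos.mpr Fintype.card_pos
  obtain ⟨u, -, hu⟩ := Finset.exists_le_of_sum_le hne (f := ν) (g := fun _ => (1 : ℝ) / Fintype.card S)
    (by rw [hν1, sum_const, card_univ, nsmul_eq_mul, mul_one_div_cancel hcard.ne'])
  exact ⟨u, hu⟩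

omit [DecidableEq S] in
/-- **RARE COLD STARTS EXIST: `4K ≤ |S|` ⇒ some configuration has `Σ_k μ_{k+1}(x_{k+1}) ≤ 1/4`.** [ours] -/
theorem exists_rare_coldStart (hμ1 : ∀ k, ∑ u, μ k u = 1) (hS : 4 * K ≤ Fintype.card S) :
    ∃ x : Fin (K + 1) → S, ∑ k : Fin K, μ k.succ (x k.succ) ≤ 1 / 4 := by
  choose u hu using fun k => exists_apply_le_inv_card (hμ1 k)
  refine ⟨u, ?_⟩
  rcases Nat.eq_zero_or_pos K with hK0 | hKpos
  · subst hK0; simp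
  · have hcard : (0 : ℝ) < Fintype.card S := by
      have : 0 < Fintype.card S := by omega
      exact_mod_cast this
    have hS' : (4 : ℝ) * K ≤ Fintype.card S := by exact_mod_cast hS
    calc ∑ k : Fin K, μ k.succ (u k.succ) ≤ ∑ _k : Fin K, (1 : ℝ) / Fintype.card S :=
          sum_le_sum fun k _ => hu k.succ
      _ = (K : ℝ) / Fintype.card S := by rw [sum_const, card_univ, Fintype.card_fin, nsmul_eq_mul]; field_simp
      _ ≤ 1 / 4 := by rw [div_le_iff₀ hcard]; linarith

/-- **THE QUARTER LAW ON A LARGE CONFIGURATION SPACE (`|S| ≥ 4K`, `K ≥ 4`): `t_mix(1/4) ≥ (K − 1)·log(K/4)`** for every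
hub list, maps, allocation with `θ_Σ > 0`, reversible updates, scheme `1/4`-close at some time. [ours] -/
theorem hubList_mixingTime_ge_of_card (hK : 4 ≤ K) (hS : 4 * K ≤ Fintype.card S) (hm : 1 ≤ m)
    (hμ : ∀ k x, 0 < μ k x) (hμ1 : ∀ k, ∑ u, μ k u = 1) (hM : ∀ k, IsRowStochastic (M k))
    (hMrev : ∀ k, DetailedBalance (μ k) (M k)) (hw0 : ∀ k, 0 ≤ w k) (hw1 : ∑ k, w k = 1) (ht0 : 0 ≤ t) (ht1 : t ≤ 1)
    (hθpos : 0 < t + (1 - t) * (1 - w 0))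
    (hmix : ∃ t₀, worstTvDist (fun y z : Fin (K + 1) → S =>
      t * ptGraphSwap μ (fun r : Fin m => (((0 : Fin (K + 1)), (κ r).succ) : Fin (K + 1) × Fin (K + 1))) φ y z
        + (1 - t) * prodKernel w M y z) (tensorFun μ) t₀ ≤ 1 / 4) :
    ((K : ℝ) - 1) * Real.log (K / 4)
      ≤ (mixingTime (fun y z : Fin (K + 1) → S =>
          t * ptGraphSwap μ (fun r : Fin m => (((0 : Fin (K + 1)), (κ r).succ) : Fin (K + 1) × Fin (K + 1))) φ y z
            + (1 - t) * prodKernel w M y z) (tensorFun μ) (1 / 4) : ℝ) := by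
  obtain ⟨x, hx⟩ := exists_rare_coldStart (μ := μ) hμ1 hS
  exact hubList_mixingTime_ge_linearLog κ φ hK hm hμ hμ1 hM hMrev hw0 hw1 ht0 ht1 hθpos x hx hmix

end Law

end Summit.Ventures.LatticeQCDFlow.Scaling

end
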